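import Literature.AlgebraicGeometry.AbelianSchemes.PolarizedTupleIsoRebase     -- ★ (R1) `exists_tupleIso_baseChange_iff_comp`
import Literature.AlgebraicGeometry.AbelianSchemes.TupleRelSymm                -- ★ `exists_tupleRel_id_symm`
import Literature.AlgebraicGeometry.AbelianSchemes.TupleIsoAtOfFibreIso        -- ★ `tupleRel_comp_id_id`
import HarnessLib

/-!
# Separation of sheet points transported from a tuple READING a twice-pulled-back tuple (the `ESepAt` + `gen_iso` ⇒ generic-injectivity step of `stub_INJ0`)

Topic `AlgebraicGeometry/AbelianSchemes`; namespace `Literature.AlgebraicGeometry.AbelianSchemes.AbelianSchemeOver`.  THEOREMS ONLY (no definition, no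
instance, no notation, no named fact, no `sorry`); universe-polymorphic.  Cell `hodgecm-mathlib` (D-0151), P6 «MOD programme» (crux hLiu418 =
stmt-HodgeConjecture-24832, `--supports`, count-neutral); P-LINE ED. 2 closer leaf `Lines/F0_P6a_PELSpread.lean`, socket `stub_INJ0` (LA4-plan DEAL v3, LA4-p03
assembly owner) — the v6f `stub_INJ` recipe made generic.  HC_CM is proved only modulo the printed citations until rung 0 closes; nothing here is about HC.

THE MATHEMATICS ([MumfordFogartyKirwan1994] Ch. 7 §2 Def. 7.2, Prop. 7.3).  `Z →[gI] Y₀ →[L] Y`, a tuple `(𝒜, ι, Â, 𝒫, λ, lvl)` over `Y`, a tuple `B` over `Z`, and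
a family of `T`-points `ℓ i : T → Z` (`T` reduced, connected, locally Noetherian — a geometric point).  If (readB) at every `ℓ i` the tuple `(L^*𝒜)|_{gI}` READS
`B` (an isomorphism of tuples `((𝒜 ×_Y Y₀) ×_{Y₀} Z) ×_Z T ≅ B ×_Z T` along `𝟙 T`, the six clauses) and (sepB) `B` SEPARATES the family (`B` isomorphic at
`(ℓ i, ℓ j)` forces `i = j`), then `𝒜` separates the family `ℓ i ≫ gI ≫ L`: an isomorphism of `𝒜` at `(ℓ i ≫ gI ≫ L, ℓ j ≫ gI ≫ L)` is rebased twice (★ (R1)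
`exists_tupleIso_baseChange_iff_comp`) to one of `(L^*𝒜)|_{gI}` at `(ℓ i, ℓ j)`, flanked by the reading at `ℓ i` INVERTED (★ `exists_tupleRel_id_symm`, Poincaré
sheaves normalised by ★ `Polarization.nonempty_unitHatSlice_iso`) and the reading at `ℓ j` (★ `tupleRel_comp_id_id`), and (sepB) concludes.  In the P6a
line: `T = Spec Ω̄_w`, `Z = X ⊗_F Fᵢ`, `Y₀ = 𝓨_(w)`, `Y` = the stage, `gI = genIncl`, `L = stageLocLeg`, `B` = the E-tuple, `ℓ y = ℓ_e y`, readB = `T.gen_iso e`,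
sepB = `ESepAt … T.E` on the sheet `e`.

* `forall_eq_of_tupleIso_comp_comp_of_reads_of_separates` — THE HEAD.

## References
* [MumfordFogartyKirwan1994] D. Mumford, J. Fogarty, F. Kirwan, *Geometric Invariant Theory*, 3rd ed. (1994), Ch. 7 §2 Def. 7.2 (p. 129), Prop. 7.3 (p. 132).
* [GortzWedhorn2020] U. Görtz, T. Wedhorn, *Algebraic Geometry I*, 2nd ed. (2020), Section (4.7) (pp. 107–108).
* [RapoportSmithlingZhang2020Diagonal] M. Rapoport, B. Smithling, W. Zhang, Compos. Math. 156 (2020), §4.1 Thm. 4.1 (p. 17).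
-/

set_option autoImplicit false

noncomputable section

-- Mathlib's `Over`/pull-back API is stated across semireducible wrappers (as in the ★ `AbelianSchemes/*` files).
set_option backward.isDefEq.respectTransparency false

universe u

open CategoryTheory CategoryTheory.Limits AlgebraicGeometry

namespace Literature.AlgebraicGeometry.AbelianSchemes

namespace AbelianSchemeOver

variable {T Z Y₀ Y : Scheme.{u}} [IsReduced T] [IsLocallyNoetherian T] [PreconnectedSpace T]
  (gI : Z ⟶ Y₀) (L : Y₀ ⟶ Y) {O : Type*} [CommRing O]
  (𝒜 : AbelianSchemeOver Y) (ρ : RingAction O 𝒜) (D : 𝒜.DualPair) (pol : 𝒜.Polarization D) {g N : ℕ} (lvl : 𝒜.LevelStructure g N)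
  (B : AbelianSchemeOver Z) (ρB : RingAction O B) (DB : B.DualPair) (polB : B.Polarization DB) (lvlB : B.LevelStructure g N)
  {ι : Type*} (ℓ : ι → (T ⟶ Z))

/-- **HEAD — `𝒜` SEPARATES THE POINTS `ℓ i ≫ gI ≫ L` WHEN A TUPLE `B` READING `(L^*𝒜)|_{gI}` AT THE `ℓ i` SEPARATES THE `ℓ i`.**  (sepB) and (readB) are
the six-clause letters UNFOLDED (the P-line's `ESepAt … e` and `T.gen_iso e`); the conclusion is ★ (GS-3)'s injectivity clause for `𝒜` at the two points
`ℓ i ≫ gI ≫ L`, `ℓ j ≫ gI ≫ L`. [cite: MumfordFogartyKirwan1994, Ch. 7 §2 Definition 7.2 (p. 129) and Proposition 7.3 (p. 132)]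
[cite: GortzWedhorn2020, Section (4.7) (pp. 107–108)] [cite: RapoportSmithlingZhang2020Diagonal, §4.1 Thm. 4.1 p. 17] -/
theorem forall_eq_of_tupleIso_comp_comp_of_reads_of_separates
    (sepB : ∀ i j : ι,
      (∃ (G : (B.baseChange (ℓ i)).X.left ⟶ (B.baseChange (ℓ j)).X.left) (Ĝ : (DB.baseChange (ℓ i)).hat.X.left ⟶ (DB.baseChange (ℓ j)).hat.X.left),
        (lvlB.baseChange (ℓ i)).IsBaseChangeVia (lvlB.baseChange (ℓ j)) (𝟙 T) G ∧
        (DB.baseChange (ℓ i)).hat.IsBaseChangeVia (DB.baseChange (ℓ j)).hat (𝟙 T) Ĝ ∧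
        (∃ (wG : (B.baseChange (ℓ i)).X.hom ≫ 𝟙 T = G ≫ (B.baseChange (ℓ j)).X.hom)
            (wĜ : (DB.baseChange (ℓ i)).hat.X.hom ≫ 𝟙 T = Ĝ ≫ (DB.baseChange (ℓ j)).hat.X.hom),
          Nonempty ((Scheme.Modules.pullback
            (pullback.map (B.baseChange (ℓ i)).X.hom (DB.baseChange (ℓ i)).hat.X.hom (B.baseChange (ℓ j)).X.hom (DB.baseChange (ℓ j)).hat.X.hom
              G Ĝ (𝟙 T) wG wĜ)).obj (DB.baseChange (ℓ j)).P ≅ (DB.baseChange (ℓ i)).P)) ∧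
        (polB.baseChange (ℓ i)).lam.left ≫ Ĝ = G ≫ (polB.baseChange (ℓ j)).lam.left ∧
        ∀ a : O, (baseChangeHom (ρB.i a) (ℓ i)).left ≫ G = G ≫ (baseChangeHom (ρB.i a) (ℓ j)).left) → i = j)
    (readB : ∀ i : ι,
      ∃ (G : (((𝒜.baseChange L).baseChange gI).baseChange (ℓ i)).X.left ⟶ (B.baseChange (ℓ i)).X.left)
        (Ĝ : (((D.baseChange L).baseChange gI).baseChange (ℓ i)).hat.X.left ⟶ (DB.baseChange (ℓ i)).hat.X.left),
        (((lvl.baseChange L).baseChange gI).baseChange (ℓ i)).IsBaseChangeVia (lvlB.baseChange (ℓ i)) (𝟙 T) G ∧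
        (((D.baseChange L).baseChange gI).baseChange (ℓ i)).hat.IsBaseChangeVia (DB.baseChange (ℓ i)).hat (𝟙 T) Ĝ ∧
        (∃ (wG : (((𝒜.baseChange L).baseChange gI).baseChange (ℓ i)).X.hom ≫ 𝟙 T = G ≫ (B.baseChange (ℓ i)).X.hom)
            (wĜ : (((D.baseChange L).baseChange gI).baseChange (ℓ i)).hat.X.hom ≫ 𝟙 T = Ĝ ≫ (DB.baseChange (ℓ i)).hat.X.hom),
          Nonempty ((Scheme.Modules.pullback
            (pullback.map (((𝒜.baseChange L).baseChange gI).baseChange (ℓ i)).X.hom (((D.baseChange L).baseChange gI).baseChange (ℓ i)).hat.X.hom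
              (B.baseChange (ℓ i)).X.hom (DB.baseChange (ℓ i)).hat.X.hom G Ĝ (𝟙 T) wG wĜ)).obj (DB.baseChange (ℓ i)).P ≅
            (((D.baseChange L).baseChange gI).baseChange (ℓ i)).P)) ∧
        (((pol.baseChange L).baseChange gI).baseChange (ℓ i)).lam.left ≫ Ĝ = G ≫ (polB.baseChange (ℓ i)).lam.left ∧
        ∀ a : O, (baseChangeHom (((ρ.baseChange L).baseChange gI).i a) (ℓ i)).left ≫ G = G ≫ (baseChangeHom (ρB.i a) (ℓ i)).left) :
    ∀ i j : ι,
      (∃ (G : (𝒜.baseChange (ℓ i ≫ gI ≫ L)).X.left ⟶ (𝒜.baseChange (ℓ j ≫ gI ≫ L)).X.left)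
          (Ĝ : (D.baseChange (ℓ i ≫ gI ≫ L)).hat.X.left ⟶ (D.baseChange (ℓ j ≫ gI ≫ L)).hat.X.left),
        (lvl.baseChange (ℓ i ≫ gI ≫ L)).IsBaseChangeVia (lvl.baseChange (ℓ j ≫ gI ≫ L)) (𝟙 T) G ∧
        (D.baseChange (ℓ i ≫ gI ≫ L)).hat.IsBaseChangeVia (D.baseChange (ℓ j ≫ gI ≫ L)).hat (𝟙 T) Ĝ ∧
        (∃ (wG : (𝒜.baseChange (ℓ i ≫ gI ≫ L)).X.hom ≫ 𝟙 T = G ≫ (𝒜.baseChange (ℓ j ≫ gI ≫ L)).X.hom)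
            (wĜ : (D.baseChange (ℓ i ≫ gI ≫ L)).hat.X.hom ≫ 𝟙 T = Ĝ ≫ (D.baseChange (ℓ j ≫ gI ≫ L)).hat.X.hom),
          Nonempty ((Scheme.Modules.pullback
            (pullback.map (𝒜.baseChange (ℓ i ≫ gI ≫ L)).X.hom (D.baseChange (ℓ i ≫ gI ≫ L)).hat.X.hom
              (𝒜.baseChange (ℓ j ≫ gI ≫ L)).X.hom (D.baseChange (ℓ j ≫ gI ≫ L)).hat.X.hom G Ĝ (𝟙 T) wG wĜ)).obj
              (D.baseChange (ℓ j ≫ gI ≫ L)).P ≅ (D.baseChange (ℓ i ≫ gI ≫ L)).P)) ∧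
        (pol.baseChange (ℓ i ≫ gI ≫ L)).lam.left ≫ Ĝ = G ≫ (pol.baseChange (ℓ j ≫ gI ≫ L)).lam.left ∧
        ∀ a : O, (baseChangeHom (ρ.i a) (ℓ i ≫ gI ≫ L)).left ≫ G = G ≫ (baseChangeHom (ρ.i a) (ℓ j ≫ gI ≫ L)).left) → i = j := by
  intro i j hiso
  -- rebase twice: `𝒜` at `(ℓ ≫ gI) ≫ L` → `L^*𝒜` at `ℓ ≫ gI` → `(L^*𝒜)|_{gI}` at `ℓ`
  rw [← Category.assoc (ℓ i) gI L, ← Category.assoc (ℓ j) gI L] at hiso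
  have h1 := (exists_tupleIso_baseChange_iff_comp 𝒜 ρ D pol lvl L (ℓ i ≫ gI) (ℓ j ≫ gI)).mpr hiso
  obtain ⟨G, Ĝ, hr⟩ := (exists_tupleIso_baseChange_iff_comp (𝒜.baseChange L) (ρ.baseChange L) (D.baseChange L) (pol.baseChange L)
    (lvl.baseChange L) gI (ℓ i) (ℓ j)).mpr h1
  -- the readings at `ℓ i` (inverted) and at `ℓ j`
  obtain ⟨G₁, Ĝ₁, r₁⟩ := readB i
  obtain ⟨G₂, Ĝ₂, r₂⟩ := readB j
  haveI := (((pol.baseChange L).baseChange gI).baseChange (ℓ i)).isMonHom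
  obtain ⟨G₁', Ĝ₁', r₁'⟩ := exists_tupleRel_id_symm (((D.baseChange L).baseChange gI).baseChange (ℓ i)) (DB.baseChange (ℓ i))
    (((pol.baseChange L).baseChange gI).baseChange (ℓ i)).lam (polB.baseChange (ℓ i)).lam
    (((pol.baseChange L).baseChange gI).baseChange (ℓ i)).nonempty_unitHatSlice_iso (polB.baseChange (ℓ i)).nonempty_unitHatSlice_iso
    (((lvl.baseChange L).baseChange gI).baseChange (ℓ i)) (lvlB.baseChange (ℓ i))
    (fun a => baseChangeHom (((ρ.baseChange L).baseChange gI).i a) (ℓ i)) (fun a => baseChangeHom (ρB.i a) (ℓ i)) r₁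
  -- compose `B@ℓi → (L^*𝒜)|gI @ℓi → (L^*𝒜)|gI @ℓj → B@ℓj` and separate
  exact sepB i j ⟨_, _, tupleRel_comp_id_id (tupleRel_comp_id_id r₁' hr) r₂⟩

end AbelianSchemeOver

end Literature.AlgebraicGeometry.AbelianSchemes

end
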